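import Literature.MathematicalPhysics.QuantumFieldTheory.Balaban1983to89.B9DirSupAtPins
import Literature.MathematicalPhysics.QuantumFieldTheory.Balaban1983to89.B9Thm310WholeDir

/-!
# `Balaban1983to89.B9DirSupSqAtPinsA` — THE PER-DIRECTION (3.42)₂ ENTRY TRANSFER FOR THEOREM 3.10's LOCAL OPERATORS `G_□(U)`, `DirSupSq310` (dag-n06-c's R1′-A schema
# `B9Thm310WholeDir.DirSupSq310`), HOLDS AT THE BOND-SECTOR PINS of the N06 certificate — the A-side twin of `B9DirSupAtPins.dirSupSq37_of_pins ∕ dirSupSq37_pins`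
# by the same slice relabelling, under the one SHAPE pin «`G_□(U)` is read slice by slice by one bond operator»

T. Bałaban, *Propagators for lattice gauge theories in a background field*, Commun. Math. Phys. **99** (1985) 389–434
[`Balaban1985BackgroundPropagators`, "B9"]; [4] = T. Bałaban, *Propagators and renormalization transformations for lattice gauge
theories. II*, Commun. Math. Phys. **96** (1984) 223–250 [`Balaban1984PropagatorsII`].

statement-level skeleton of published theorems with citation tags; proofs where landed; nothing here is a claim about the Yang–Mills
mass gap

THE PRINTED LOCI.  [B9] (3.39)–(3.40) p. 397 (the sup norm of vector-valued lattice functions runs over the direction index), (3.42) p. 397 (the entries of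
Theorem 3.3 for `G(U)`, in particular `∇_U G(U)` and `G(U)∇*_U`), Cor. 3.6 p. 408 (the same estimates for the local operators `G_□(U)`), Thm 3.10 p. 416;
[4] (2.51) p. 232 (block majorants).

THE POINT (cell `pub-ymgap`, node N06; width seat w5's trigger t3 «n06-c types a `DirSupSq310` schema ⇒ same relabelling, one file»; knit owner dag-n06-d g11
INTENT-3 l.35036 «if you type `dirSupSq310_pins` … I consume it in ED.33»).  dag-n06-c's R1′ re-threading of Theorem 3.10's algebraic schema over the direction letters
displays the entry transfer `DirSupSq310 (𝔬A x) (𝔡A x) R H U` in the certificate's `h36A` once the A-side edition lands: «a two-space sup majorant of `∇_U ∘ G_□` is a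
majorant of every `∇_{U,μ} ∘ G_□`, one of `G_□ ∘ ∇*_U` is one of every `G_□ ∘ ∇*_{U,μ}`».  At the bond-sector pins `∇_U = DcoK` ∕ `∇*_U = DscoK` read ALL direction slices
(`coordOpK b (fun μ => ∇_{U,μ})`), the direction letters are the constant-slice models `coordOpK b (fun _ => ∇_{U,μ})` (`h𝔡Ad ∕ h𝔡As`), the block maps `blkBK bI` are
slot-blind (`hblkA ∕ hblkYA`) — so with the ONE shape pin `hGsq : ∀ □, ∃ r G, 𝔬.Gsq U □ = r • coordOpK b (fun _ => G)` (the cube operators read slice by slice by one bond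
operator, the shape of node00-def-Y's walk-letter instance `GAsqY`) the predecessor's `hasMajorant_constSlice_of_family` gives the transfer:
* §1 ★★ `dirSupSq310_of_pins` (generic coordinate data `b B cfg bI`, every `U`, no regularity); §2 ★★ `dirSupSq310_pins` (member level, the certificate's pin texts
  `hblkA hblkYA hDcoA hDscoA h𝔡Ad h𝔡As` VERBATIM + the shape pin).

HONEST SCOPE.  Relabelling algebra over n06-d's `coordOpK`; no estimate of [B9] asserted (the majorants `m` are the schema's own hypotheses); COUNT-NEUTRAL; N06 is NOT
discharged; one finite lattice at a time; nothing continuum, nothing about the mass gap ∕ Clay.  Cell `pub-ymgap` (HUMAN RULING D-0062 ∕ D-0154), Track A node N06 [B9],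
width seat `pub-ymgap-dag-n06-w5` (g0′), 2026-08-28.
-/

noncomputable section

namespace Literature.MathematicalPhysics.QuantumFieldTheory.Balaban1983to89.B9DirSupSqAtPinsA

open B6KLevelCensusIndexV1 (KIdx)
open B6RandomWalk (HasMajorant BlockSupp)
open B6RandomWalkHom (HasMajorantHom)
open B9Thm34Ext (toB6)
open B9Thm310Whole (Ops310)
open B9RWSums346SecondDiff (DirOps310)
open B9Thm310WholeDir (DirSupSq310)
open B9GeoNormsKLevelV1 (geo9K)
open B9CoReadingCoords (coordOpK coordOpK_comp XBK blkBK DcoK DscoK cdBₗ cdsBₗ)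
open B9DirSupAtPins (hasMajorant_constSlice_of_family smul_coordOpK_comp_smul_coordOpK)
open Node00

variable {d ℓ : ℕ} {hd : 1 ≤ d + 1} {hL : Odd (ℓ + 1) ∧ 1 < ℓ + 1} {b₀ b₁ : ℝ}

/-! ## §1 The transfer at n06-d's bond-sector pins, every configuration -/

section Pins

variable {𝔸 : Type} [NormedRing 𝔸] [NormedAlgebra ℂ 𝔸] [CompleteSpace 𝔸]
variable {κ : Type} [Fintype κ] (i : KIdx d ℓ hd hL b₀ b₁) (b : Module.Basis κ ℝ 𝔸) (B : B9.Backgrounds) (cfg : B.Cfg → CfgY 𝔸 i)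
variable [Fintype (geo9K i).Site] {ι A : Type}

/-- ★★ **`DirSupSq310` AT THE BOND-SECTOR PINS, EVERY CONFIGURATION** (dag-n06-c's R1′-A schema, the A-side twin of `dirSupSq37_of_pins`): for any Theorem-3.10 letter record
over n06-d's bond carrier `XBK` whose block maps are the slot-blind `blkBK i bI` and whose `∇_U ∕ ∇*_U` at `U₁` are def-Y's slice-by-slice models `DcoK ∕ DscoK`, direction
letters pinned to the constant-slice models (the certificate's `hDcoA ∕ hDscoA ∕ h𝔡Ad ∕ h𝔡As ∕ hblkA ∕ hblkYA`), and cube operators `G_□(U₁)` of the slice-by-slice shape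
`r • coordOpK b (fun _ => G)` (`hGsq`), the entries `∇_U ∘ G_□`, `G_□ ∘ ∇*_U` transfer to every direction.
[cite: Balaban1985BackgroundPropagators, Cor. 3.6 p.408 + (3.39) p.397 + (3.42) p.397 + Thm 3.10 p.416; Balaban1984PropagatorsII, (2.51) p.232] -/
theorem dirSupSq310_of_pins (𝔬 : Ops310 (geo9K i) B (XBK κ i) (XBK κ i) ι A) (𝔡 : DirOps310 𝔬 (Fin (d + 1)))
    {bI : FBondY i → IBondY i} (hblk : 𝔬.blk = blkBK i bI) (hblkY : 𝔬.blkY = blkBK i bI) {U₁ : B.Cfg}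
    (hD : 𝔬.D U₁ = DcoK i b B cfg U₁) (hDs : 𝔬.Dstar U₁ = DscoK i b B cfg U₁)
    (hDd : 𝔡.Dd U₁ = fun μ => coordOpK b (fun _ : Fin (d + 1) => cdBₗ i (cfg U₁) μ))
    (hDsd : 𝔡.Dsd U₁ = fun μ => coordOpK b (fun _ : Fin (d + 1) => cdsBₗ i (cfg U₁) μ))
    (hGsq : ∀ j : ι, ∃ (r : ℝ) (G : (FBondY i → 𝔸) →ₗ[ℝ] (FBondY i → 𝔸)), 𝔬.Gsq U₁ j = r • coordOpK b (fun _ : Fin (d + 1) => G))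
    {R : ℝ} {H : Prop} : DirSupSq310 𝔬 𝔡 R H U₁ := by
  refine ⟨fun j m hm ν => ?_, fun j m hm μ => ?_⟩
  · obtain ⟨r, G, hG⟩ := hGsq j
    rw [hblk, hblkY, hD, hG] at hm
    rw [hblk, hDd, hG]
    change HasMajorant (g := toB6 (geo9K i) R H) (fun p : XBK κ i => bI p.1)
      ((coordOpK b (fun _ : Fin (d + 1) => cdBₗ i (cfg U₁) ν)) ∘ₗ (r • coordOpK b (fun _ : Fin (d + 1) => G))) m
    change HasMajorantHom (g := toB6 (geo9K i) R H) (fun p : XBK κ i => bI p.1) (fun p : XBK κ i => bI p.1)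
      ((coordOpK b (fun μ : Fin (d + 1) => cdBₗ i (cfg U₁) μ)) ∘ₗ (r • coordOpK b (fun _ : Fin (d + 1) => G))) m at hm
    rw [← one_smul ℝ (coordOpK b (fun _ : Fin (d + 1) => cdBₗ i (cfg U₁) ν)), smul_coordOpK_comp_smul_coordOpK]
    rw [← one_smul ℝ (coordOpK b (fun μ : Fin (d + 1) => cdBₗ i (cfg U₁) μ)), smul_coordOpK_comp_smul_coordOpK] at hm
    exact hasMajorant_constSlice_of_family b (G := toB6 (geo9K i) R H) bI
      (fun μ : Fin (d + 1) => cdBₗ i (cfg U₁) μ ∘ₗ G) _ hm ν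
  · obtain ⟨r, G, hG⟩ := hGsq j
    rw [hblk, hblkY, hDs, hG] at hm
    rw [hblk, hDsd, hG]
    change HasMajorant (g := toB6 (geo9K i) R H) (fun p : XBK κ i => bI p.1)
      ((r • coordOpK b (fun _ : Fin (d + 1) => G)) ∘ₗ (coordOpK b (fun _ : Fin (d + 1) => cdsBₗ i (cfg U₁) μ))) m
    change HasMajorantHom (g := toB6 (geo9K i) R H) (fun p : XBK κ i => bI p.1) (fun p : XBK κ i => bI p.1)
      ((r • coordOpK b (fun _ : Fin (d + 1) => G)) ∘ₗ (coordOpK b (fun ν : Fin (d + 1) => cdsBₗ i (cfg U₁) ν))) m at hm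
    rw [← one_smul ℝ (coordOpK b (fun _ : Fin (d + 1) => cdsBₗ i (cfg U₁) μ)), smul_coordOpK_comp_smul_coordOpK]
    rw [← one_smul ℝ (coordOpK b (fun ν : Fin (d + 1) => cdsBₗ i (cfg U₁) ν)), smul_coordOpK_comp_smul_coordOpK] at hm
    exact hasMajorant_constSlice_of_family b (G := toB6 (geo9K i) R H) bI
      (fun ν : Fin (d + 1) => G ∘ₗ cdsBₗ i (cfg U₁) ν) _ hm μ

end Pins

/-! ## §2 At node00-def-Y's members, with the certificate's A-side pins verbatim -/

section Members

open scoped Matrix.Norms.L2Operator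
open B7Prop2SpecialUnitary (specialUnitaryUnits)
open B9PinMembersKLevelV1 (MemberY geo9Y bg9Y)
open B9CoReadingCoordsTranspose (TrIdx trBasis)

variable {Mstar : ℕ} {N : ℕ}
variable [∀ x : MemberY d ℓ hd hL b₀ b₁ Mstar, Fintype (geo9Y x).Site]

/-- ★★ **`DirSupSq310 (𝔬A x) (𝔡A x) R H U` AT THE CERTIFICATE'S PINS, EVERY MEMBER, EVERY `U`** (pin texts `hblkA ∕ hblkYA ∕ hDcoA ∕ hDscoA ∕ h𝔡Ad ∕ h𝔡As` of editions ≥ 17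
verbatim, plus the ONE shape pin `hGsqA` on the cube operators — the form dag-n06-d displays until node00-def-Y's A-side walk-letter instance pins `(𝔬A x).Gsq` to a
`coordOpK`-model of `GAsqY`, when it becomes `⟨_, _, rfl⟩`): the conjunct `DirSupSq310` of the R1′-A `h36A` is a theorem of the pins.
[cite: Balaban1985BackgroundPropagators, Cor. 3.6 p.408 + (3.42) p.397 + Thm 3.10 p.416; Balaban1984PropagatorsII, (2.51) p.232] -/
theorem dirSupSq310_pins (x : MemberY d ℓ hd hL b₀ b₁ Mstar) {ι A : Type}
    (𝔬 : Ops310 (geo9Y x) (bg9Y (Matrix (Fin N) (Fin N) ℂ) (specialUnitaryUnits (Fin N)) x) (XBK (TrIdx N) x.toKIdx) (XBK (TrIdx N) x.toKIdx) ι A)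
    (𝔡 : DirOps310 𝔬 (Fin (d + 1))) {bI : FBondY x.toKIdx → IBondY x.toKIdx}
    (hblkA : 𝔬.blk = blkBK x.toKIdx bI) (hblkYA : 𝔬.blkY = blkBK x.toKIdx bI)
    {U : (bg9Y (Matrix (Fin N) (Fin N) ℂ) (specialUnitaryUnits (Fin N)) x).Cfg}
    (hDcoA : 𝔬.D U = DcoK x.toKIdx (trBasis N) (bg9Y (Matrix (Fin N) (Fin N) ℂ) (specialUnitaryUnits (Fin N)) x) (fun U => U) U)
    (hDscoA : 𝔬.Dstar U = DscoK x.toKIdx (trBasis N) (bg9Y (Matrix (Fin N) (Fin N) ℂ) (specialUnitaryUnits (Fin N)) x) (fun U => U) U)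
    (h𝔡Ad : 𝔡.Dd U = fun μ => coordOpK (trBasis N) (fun _ : Fin (d + 1) => cdBₗ x.toKIdx U μ))
    (h𝔡As : 𝔡.Dsd U = fun μ => coordOpK (trBasis N) (fun _ : Fin (d + 1) => cdsBₗ x.toKIdx U μ))
    (hGsqA : ∀ j : ι, ∃ (r : ℝ) (G : (FBondY x.toKIdx → Matrix (Fin N) (Fin N) ℂ) →ₗ[ℝ] (FBondY x.toKIdx → Matrix (Fin N) (Fin N) ℂ)),
      𝔬.Gsq U j = r • coordOpK (trBasis N) (fun _ : Fin (d + 1) => G))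
    {R : ℝ} {H : Prop} : DirSupSq310 𝔬 𝔡 R H U := by
  letI : Fintype (geo9K x.toKIdx).Site := (inferInstance : Fintype (geo9Y x).Site)
  exact dirSupSq310_of_pins x.toKIdx (trBasis N) (bg9Y (Matrix (Fin N) (Fin N) ℂ) (specialUnitaryUnits (Fin N)) x) (fun U => U) 𝔬 𝔡
    hblkA hblkYA hDcoA hDscoA h𝔡Ad h𝔡As hGsqA

end Members

end Literature.MathematicalPhysics.QuantumFieldTheory.Balaban1983to89.B9DirSupSqAtPinsA

end
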